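import Summits.QuantumFields.YangMills.Theorems.EquipartitionCriticalityCriticalContinuumLimitBentCumulantRPCSTorus
import HarnessLib

/-!
# `CriticalContinuumLimit` — line `Sketch`, stub `stub_bentCumulantCS` (torus input (T-CS)),
# part 2/3: half-space bookkeeping and the stub in expanded form

Support file for crux `stmt-QuantumFields-8762`
(`Summit.QuantumFields.YangMills.Theses.EquipartitionCriticality.CriticalContinuumLimit`), stub
`stub_bentCumulantCS` of line `Sketch` (skeleton `Cruxes/CriticalContinuumLimit/Lines/Sketch.lean`).
This part proves the registered sub-goal `stub_bentCumulantCS_expanded`: the stub with the line's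
object `bentCumulant` (the bent third cumulant) written out, the three observables entering as
bound functions `X, Y, Z` with their defining equations; part 1
(`EquipartitionCriticalityCriticalContinuumLimitBentCumulantRPCSTorus.lean`) is the torus layer, part 3
(`EquipartitionCriticalityCriticalContinuumLimitStubBentCumulantCS.lean`) files `bentCumulant` and
derives the registered stub verbatim (definitional unfolding). No definitions here.

**Statement.** `r` a lattice representation of the compact group `G`, `β ≥ 0`, `A` a bounded
gauge-invariant cylinder observable, `P = r.curvature.F` (Wilson's action density at the origin),
`Θ = gaugeTimeReflect` (bond reflection `x₀ ↦ -1-x₀` of `ℤ⁴`). There are `C` and `t₀` such that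
for all `s ≥ 1`, `u`, on all large odd tori `(ℤ/(2S+1)ℤ)⁴`, `|κ₃(s + t₀, u)| ≤ C · a_S(2s)^{1/2}`,
where `κ₃(t, u)` is the third cumulant `E[XZY] − E[X]E[ZY] − E[Z]E[XY] − E[Y]E[XZ] + 2E[X]E[Z]E[Y]`
of `X = A` at `(−t, +u e₁)`, `Z = P` at the origin, `Y = A` at `(−t, −u e₁)` (read on the periodic
lift) under Wilson's torus state, and `a_S(n) = latticeConnectedCorr r.ρ β (2S+1) (P ∘ Θ) P n` is the
`Θ`-paired curvature correlator.

**Proof.** Write `L = 2S+1`, `μ = wilsonMeasure r.ρ β` on the torus of side `L`, `Θ_T` = Wave 0's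
torus reflection `GaugeConfig.timeReflect` (`t ↦ 1 - t`), `T_v = torusConfigShift v`.
* *Cumulant identity* (part 1): `κ₃ = Cov(XY, Z) − E[X] Cov(Y, Z) − E[Y] Cov(X, Z)`.
* *Translation* (`wilsonMeasure_map_torusConfigShift`): `Cov(F, Z) = Cov(F ∘ T_w, Z ∘ T_w)` with
  `w = -(s+1) e₀`; `Z ∘ T_w` reads the links of `P` (based at times `0, 1`,
  `BentCumulantCS.curvature_supp_time`) at times `s + 1, s + 2`, inside the closed positive half once
  `S ≥ s + 2` (`BentCumulantCS.dependsOn_lift_of_pos`), while with `t₀ = T_A + 2`, `T_A` the maximal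
  `|x₀|` over the support of `A`, the translates `X ∘ T_w`, `Y ∘ T_w` read links at times in
  `[-2T_A - 1, -1]`, inside the negative half once `S ≥ 2 T_A + 1`
  (`BentCumulantCS.dependsOn_lift_of_neg`; the spatial offset `± u e₁` is immaterial).
* *RP Cauchy–Schwarz* (part 1, `BentCumulantCS.abs_cov_le_of_neg_pos`): for `F` on the negative
  half, `|F| ≤ B_F`, and `K` on the positive half, `|Cov(F, K)| ≤ 2 B_F · Cov(K ∘ Θ_T, K)^{1/2}`.
* *Bridge* (part 1, `BentCumulantCS.corr_theta_two_mul`): `Cov((Z∘T_w) ∘ Θ_T, Z∘T_w) = a_S(2s)`.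
Hence `|κ₃| ≤ (2B² + 2B·B + 2B·B) a_S(2s)^{1/2} = 6 B² a_S(2s)^{1/2}`, `B = ‖A‖∞`, for
`S ≥ 2T_A + s + 2`.

References: K. Osterwalder, E. Seiler, Ann. Phys. 110 (1978) 440, §2; E. Seiler, LNP 159 (1982)
Ch. 2; J. Glimm, A. Jaffe, *Quantum Physics* (1987) §6.1 and §19.
-/

noncomputable section

open MeasureTheory Filter Topology ProbabilityTheory
open Literature.MathematicalPhysics.AQFT Literature.MathematicalPhysics.QuantumLattice
open Literature.MathematicalPhysics.QuantumFieldTheory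

namespace Summit.QuantumFields.YangMills.Theorems.CriticalContinuumLimit

namespace BentCumulantCS

/-! ### Periodic lifts of cylinder observables: translations and half-space bookkeeping -/

section Lift

variable {G : Type} [MeasurableSpace G]

/-- Composition of translations of `ℤ⁴` configurations. [folklore] -/
theorem configShift_configShift (z w : Literature.Probability.LatticeModels.Site 4)
    (V : LGConfig 4 G) : configShift z (configShift w V) = configShift (z + w) V := by
  funext e
  simp only [configShift_apply, sub_sub]

/-- The periodic lift of a torus translate is a translate of the periodic lift:
`lift (T_{proj w} U) = configShift w (lift U)`. [folklore] -/
theorem torusLift_torusConfigShift (L : ℕ) (w : Literature.Probability.LatticeModels.Site 4)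
    (U : GaugeConfig 4 L G) :
    torusLift L (torusConfigShift (Literature.Probability.LatticeModels.Torus.proj L w) U) =
      configShift w (torusLift L U) :=
  (EquipartitionCriticality.RPProbe.configShift_torusLift L w U).symm

variable {S : ℕ}

/-- **Negative-half bookkeeping.** If every link of the support of the cylinder observable `F`,
translated by `-z`, sits at a time in `[-S, -1]`, then `F ∘ configShift z ∘ lift` depends only on
links of the odd torus `(ℤ/(2S+1)ℤ)⁴` whose `Θ_T`-reflections lie in the closed positive half
(links based in `1 ≤ t ≤ S`, spatial links at `t = S+1`). [folklore] -/
theorem dependsOn_lift_of_neg {F : LGConfig 4 G → ℝ}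
    {Λ : Finset (Literature.MathematicalPhysics.QuantumLattice.ZdEdge 4)} (hF : IsCylinder F Λ)
    (z : Literature.Probability.LatticeModels.Site 4)
    (hz : ∀ e ∈ Λ, 1 ≤ z 0 - e.1 0 ∧ z 0 - e.1 0 ≤ (S : ℤ)) :
    DependsOn (fun U : GaugeConfig 4 (2 * S + 1) G => F (configShift z (torusLift (2 * S + 1) U)))
      {e : Edge 4 (2 * S + 1) | WilsonRP.edgeReflect e ∈
        {e : Edge 4 (2 * S + 1) | WilsonOddRP.IsOPosEdge e ∨ WilsonOddRP.IsOSharedEdge e}} := by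
  intro U V hUV
  refine hF fun e he => ?_
  simp only [configShift_apply, torusLift, Function.comp_apply, torusEdge]
  refine hUV _ ?_
  obtain ⟨h1, h2⟩ := hz e he
  obtain ⟨k, hk, hk1, hkS⟩ : ∃ k : ℕ, z 0 - e.1 0 = k ∧ 1 ≤ k ∧ k ≤ S :=
    ⟨(z 0 - e.1 0).toNat, (Int.toNat_of_nonneg (by omega)).symm, by omega, by omega⟩
  have h0 : (Literature.Probability.LatticeModels.Torus.proj (2 * S + 1) (e.1 - z)) 0 =
      -((k : ℕ) : ZMod (2 * S + 1)) := by
    rw [Literature.Probability.LatticeModels.Torus.proj_apply, Pi.sub_apply,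
      show e.1 0 - z 0 = -(k : ℤ) by omega, Int.cast_neg, Int.cast_natCast]
  exact ThetaCorrRP.reflect_slab_subset_pos hk1 hkS _ (Or.inl h0)

/-- **Positive-half bookkeeping.** If every link of the support of the cylinder observable `F`,
translated by `-z`, sits at a time in `[1, S]`, then `F ∘ configShift z ∘ lift` depends only on
links of the closed positive half of the odd torus `(ℤ/(2S+1)ℤ)⁴`. [folklore] -/
theorem dependsOn_lift_of_pos {F : LGConfig 4 G → ℝ}
    {Λ : Finset (Literature.MathematicalPhysics.QuantumLattice.ZdEdge 4)} (hF : IsCylinder F Λ)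
    (z : Literature.Probability.LatticeModels.Site 4)
    (hz : ∀ e ∈ Λ, 1 ≤ e.1 0 - z 0 ∧ e.1 0 - z 0 ≤ (S : ℤ)) :
    DependsOn (fun U : GaugeConfig 4 (2 * S + 1) G => F (configShift z (torusLift (2 * S + 1) U)))
      {e : Edge 4 (2 * S + 1) | WilsonOddRP.IsOPosEdge e ∨ WilsonOddRP.IsOSharedEdge e} := by
  intro U V hUV
  refine hF fun e he => ?_
  simp only [configShift_apply, torusLift, Function.comp_apply, torusEdge]
  refine hUV _ ?_
  obtain ⟨h1, h2⟩ := hz e he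
  obtain ⟨k, hk, hk1, hkS⟩ : ∃ k : ℕ, e.1 0 - z 0 = k ∧ 1 ≤ k ∧ k ≤ S :=
    ⟨(e.1 0 - z 0).toNat, (Int.toNat_of_nonneg (by omega)).symm, by omega, by omega⟩
  have h0 : (Literature.Probability.LatticeModels.Torus.proj (2 * S + 1) (e.1 - z)) 0 =
      ((k : ℕ) : ZMod (2 * S + 1)) := by
    rw [Literature.Probability.LatticeModels.Torus.proj_apply, Pi.sub_apply, hk, Int.cast_natCast]
  have hmem : ((Literature.Probability.LatticeModels.Torus.proj (2 * S + 1) (e.1 - z), e.2) :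
      Edge 4 (2 * S + 1)) ∈ {e : Edge 4 (2 * S + 1) | e.1 0 = ((k : ℕ) : ZMod (2 * S + 1)) ∨
        (e.1 0 = ((k : ℕ) : ZMod (2 * S + 1)) + 1 ∧ e.2 ≠ 0)} := Or.inl h0
  exact ThetaCorrRP.slab_subset_pos hk1 hkS hmem

/-- The bound `T_Λ = max_{e ∈ Λ} |x₀(e)|` on the time coordinates of a finite set of links. [folklore] -/
theorem natAbs_le_sup {Λ : Finset (Literature.MathematicalPhysics.QuantumLattice.ZdEdge 4)}
    {e : Literature.MathematicalPhysics.QuantumLattice.ZdEdge 4} (he : e ∈ Λ) :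
    (e.1 0).natAbs ≤ Λ.sup fun e => (e.1 0).natAbs :=
  Finset.le_sup (f := fun e : Literature.MathematicalPhysics.QuantumLattice.ZdEdge 4 =>
    (e.1 0).natAbs) he

end Lift

/-! ### The links of the curvature species sit at times `0` and `1` -/

section Curvature

variable {G : Type} [Group G] [TopologicalSpace G] [IsTopologicalGroup G] [CompactSpace G]
  [MeasurableSpace G] [BorelSpace G]

/-- Every link of the declared support of `r.curvature` (the sixteen origin plaquette supports) is
based at time `0` or `1`. [folklore] -/
theorem curvature_supp_time (r : LatticeRep G) :
    ∀ e ∈ r.curvature.supp, 0 ≤ e.1 0 ∧ e.1 0 ≤ 1 := by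
  intro e he
  have he' : e ∈ Finset.univ.biUnion
      (fun p : Fin 4 × Fin 4 => originPlaquetteSupport (d := 4) p.1 p.2) := he
  simp only [Finset.mem_biUnion, Finset.mem_univ, true_and, originPlaquetteSupport,
    Finset.mem_insert, Finset.mem_singleton] at he'
  obtain ⟨⟨i, j⟩, h⟩ := he'
  rcases h with rfl | rfl | rfl | rfl
  all_goals simp only [Pi.zero_apply, Pi.single_apply]
  all_goals omega

end Curvature

end BentCumulantCS

/-! ### The registered sub-goal: the stub with `bentCumulant` written out -/

/-- **Registered sub-goal `stub_bentCumulantCS_expanded` of stub `stub_bentCumulantCS`** (torus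
input (T-CS): reflection-positivity Cauchy–Schwarz for the bent cumulant, with the line's object
`bentCumulant` unfolded: `X, Y` the two `A`-translates to `(−t, ±u e₁)`, `Z` the curvature at the
origin, all read on the periodic lift of the torus of side `2S+1`, and the third cumulant
`E[XZY] − E[X]E[ZY] − E[Z]E[XY] − E[Y]E[XZ] + 2E[X]E[Z]E[Y]`).
`κ₃ = Cov(XY, Z) − E[X] Cov(Y, Z) − E[Y] Cov(X, Z)`; for `t = s + t₀(A)`, `t₀(A) = T_A + 2` (`T_A` the
maximal `|x₀|` over the links of the support of `A`), after translating by `-(s+1)e₀` each covariance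
pairs an observable of the negative half of the odd torus (bounded by `‖A‖∞` or `‖A‖∞²`) with the
curvature read at times `s+1, s+2` in the positive half, so Osterwalder–Seiler positivity in
Cauchy–Schwarz form gives `|κ₃| ≤ 6 ‖A‖∞² · a_S(2s)^{1/2}` on all tori with `S ≥ 2 T_A + s + 2`
(tree `ThetaCorrRP.cov_rpcs`, `wilsonMeasure_map_torusConfigShift`, `configShift_torusLift`,
`gaugeTimeReflect_torusLift`). [folklore] -/
theorem stub_bentCumulantCS_expanded (G : Type) [Group G] [TopologicalSpace G]
    [IsTopologicalGroup G] [CompactSpace G] [MeasurableSpace G] [BorelSpace G] (r : LatticeRep G)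
    {β : ℝ} (hβ : 0 ≤ β) (A : YMSpecies G) :
    ∃ C : ℝ, ∃ t₀ : ℕ, ∀ s u : ℕ, 1 ≤ s → ∀ᶠ S : ℕ in atTop,
      ∀ X Y Z : GaugeConfig 4 (2 * S + 1) G → ℝ,
        (X = fun U => A.F (configShift (-(-(Pi.single 0 ((s + t₀ : ℕ) : ℤ)) + Pi.single 1 (u : ℤ)))
          (torusLift (2 * S + 1) U))) →
        (Y = fun U => A.F (configShift (-(-(Pi.single 0 ((s + t₀ : ℕ) : ℤ)) - Pi.single 1 (u : ℤ)))
          (torusLift (2 * S + 1) U))) →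
        (Z = fun U => r.curvature.F (torusLift (2 * S + 1) U)) →
        |(∫ U, X U * Z U * Y U ∂(wilsonMeasure (d := 4) (L := 2 * S + 1) r.ρ β)) -
            (∫ U, X U ∂(wilsonMeasure (d := 4) (L := 2 * S + 1) r.ρ β)) *
              (∫ U, Z U * Y U ∂(wilsonMeasure (d := 4) (L := 2 * S + 1) r.ρ β)) -
            (∫ U, Z U ∂(wilsonMeasure (d := 4) (L := 2 * S + 1) r.ρ β)) *
              (∫ U, X U * Y U ∂(wilsonMeasure (d := 4) (L := 2 * S + 1) r.ρ β)) -
            (∫ U, Y U ∂(wilsonMeasure (d := 4) (L := 2 * S + 1) r.ρ β)) *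
              (∫ U, X U * Z U ∂(wilsonMeasure (d := 4) (L := 2 * S + 1) r.ρ β)) +
            2 * ((∫ U, X U ∂(wilsonMeasure (d := 4) (L := 2 * S + 1) r.ρ β)) *
              (∫ U, Z U ∂(wilsonMeasure (d := 4) (L := 2 * S + 1) r.ρ β)) *
              (∫ U, Y U ∂(wilsonMeasure (d := 4) (L := 2 * S + 1) r.ρ β)))| ≤
          C * Real.sqrt (latticeConnectedCorr r.ρ β (2 * S + 1)
                (r.curvature.F ∘ gaugeTimeReflect) r.curvature.F (2 * s)) := by
  classical
  obtain ⟨B₀, hB₀⟩ := A.bounded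
  obtain ⟨BP, hBP⟩ := r.curvature.bounded
  set B : ℝ := max B₀ 0 with hBdef
  have hB : ∀ V, |A.F V| ≤ B := fun V => (hB₀ V).trans (le_max_left _ _)
  have hB0 : 0 ≤ B := le_max_right _ _
  -- the time extent of the support of `A`
  set T : ℕ := A.supp.sup fun e => (e.1 0).natAbs with hTdef
  have hT : ∀ e ∈ A.supp, (e.1 0).natAbs ≤ T := fun e he => BentCumulantCS.natAbs_le_sup he
  refine ⟨6 * B ^ 2, T + 2, fun s u _ => ?_⟩
  refine Filter.eventually_atTop.2 ⟨2 * T + s + 2, fun S hS => ?_⟩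
  intro X Y Z hXdef hYdef hZdef
  haveI := isProbabilityMeasure_wilsonMeasure (d := 4) (L := 2 * S + 1) r.ρ r.continuous β
  have hS1 : 1 ≤ S := by omega
  -- the three observables of the bent cumulant
  set zX : Literature.Probability.LatticeModels.Site 4 :=
    -(-(Pi.single 0 ((s + (T + 2) : ℕ) : ℤ)) + Pi.single 1 (u : ℤ)) with hzX
  set zY : Literature.Probability.LatticeModels.Site 4 :=
    -(-(Pi.single 0 ((s + (T + 2) : ℕ) : ℤ)) - Pi.single 1 (u : ℤ)) with hzY
  have hXm : Measurable X := by
    rw [hXdef]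
    exact A.measurable.comp ((configShift zX).measurable.comp (measurable_torusLift _))
  have hYm : Measurable Y := by
    rw [hYdef]
    exact A.measurable.comp ((configShift zY).measurable.comp (measurable_torusLift _))
  have hZm : Measurable Z := by
    rw [hZdef]
    exact r.curvature.measurable.comp (measurable_torusLift _)
  have hbX : ∀ U, |X U| ≤ B := fun U => by
    rw [hXdef]
    exact hB _
  have hbY : ∀ U, |Y U| ≤ B := fun U => by
    rw [hYdef]
    exact hB _
  have hbZ : ∀ U, |Z U| ≤ BP := fun U => by
    rw [hZdef]
    exact hBP _
  -- Step 1: the cumulant identity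
  rw [BentCumulantCS.cumulant_eq_cov hXm hYm hZm hbX hbY hbZ]
  -- Step 2: the translation by `-(s+1)e₀`
  set w₀ : Literature.Probability.LatticeModels.Site 4 := -(Pi.single 0 ((s + 1 : ℕ) : ℤ)) with hw₀
  set w : Site 4 (2 * S + 1) := Pi.single 0 (-((s + 1 : ℕ) : ZMod (2 * S + 1))) with hw
  have hproj : Literature.Probability.LatticeModels.Torus.proj (2 * S + 1) w₀ = w := by
    rw [hw₀, EquipartitionCriticality.RPProbe.torusProj_neg,
      EquipartitionCriticality.RPProbe.torusProj_single_zero, ← Pi.single_neg]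
  have hlift : ∀ V : GaugeConfig 4 (2 * S + 1) G, torusLift (2 * S + 1) (torusConfigShift w V) =
      configShift w₀ (torusLift (2 * S + 1) V) := fun V => by
    rw [← hproj]
    exact BentCumulantCS.torusLift_torusConfigShift _ _ _
  have hXw : (fun U => X (torusConfigShift w U)) =
      fun U => A.F (configShift (zX + w₀) (torusLift (2 * S + 1) U)) := by
    funext U
    rw [hXdef]
    simp only [hlift, BentCumulantCS.configShift_configShift]
  have hYw : (fun U => Y (torusConfigShift w U)) =
      fun U => A.F (configShift (zY + w₀) (torusLift (2 * S + 1) U)) := by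
    funext U
    rw [hYdef]
    simp only [hlift, BentCumulantCS.configShift_configShift]
  have hZw : (fun U => Z (torusConfigShift w U)) =
      fun U => r.curvature.F (configShift w₀ (torusLift (2 * S + 1) U)) := by
    funext U
    rw [hZdef]
    simp only [hlift]
  -- time bookkeeping
  have h10 : (0 : Fin 4) ≠ 1 := by decide
  have hzX0 : (zX + w₀) 0 = (T : ℤ) + 1 := by
    simp only [hzX, hw₀, Pi.add_apply, Pi.neg_apply, Pi.single_eq_same, Pi.single_eq_of_ne h10]
    push_cast
    ring
  have hzY0 : (zY + w₀) 0 = (T : ℤ) + 1 := by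
    simp only [hzY, hw₀, Pi.add_apply, Pi.neg_apply, Pi.sub_apply, Pi.single_eq_same,
      Pi.single_eq_of_ne h10]
    push_cast
    ring
  have hw₀0 : w₀ 0 = -((s + 1 : ℕ) : ℤ) := by
    simp only [hw₀, Pi.neg_apply, Pi.single_eq_same]
  have hnegX : ∀ e ∈ A.supp, 1 ≤ (zX + w₀) 0 - e.1 0 ∧ (zX + w₀) 0 - e.1 0 ≤ (S : ℤ) := by
    intro e he
    have := hT e he
    rw [hzX0]
    omega
  have hnegY : ∀ e ∈ A.supp, 1 ≤ (zY + w₀) 0 - e.1 0 ∧ (zY + w₀) 0 - e.1 0 ≤ (S : ℤ) := by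
    intro e he
    have := hT e he
    rw [hzY0]
    omega
  have hposZ : ∀ e ∈ r.curvature.supp, 1 ≤ e.1 0 - w₀ 0 ∧ e.1 0 - w₀ 0 ≤ (S : ℤ) := by
    intro e he
    have := BentCumulantCS.curvature_supp_time r e he
    rw [hw₀0]
    push_cast
    omega
  -- dependence sets after the translation
  have hXD : DependsOn (fun U => X (torusConfigShift w U))
      {e : Edge 4 (2 * S + 1) | WilsonRP.edgeReflect e ∈
        {e : Edge 4 (2 * S + 1) | WilsonOddRP.IsOPosEdge e ∨ WilsonOddRP.IsOSharedEdge e}} := by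
    rw [hXw]
    exact BentCumulantCS.dependsOn_lift_of_neg A.isCylinder _ hnegX
  have hYD : DependsOn (fun U => Y (torusConfigShift w U))
      {e : Edge 4 (2 * S + 1) | WilsonRP.edgeReflect e ∈
        {e : Edge 4 (2 * S + 1) | WilsonOddRP.IsOPosEdge e ∨ WilsonOddRP.IsOSharedEdge e}} := by
    rw [hYw]
    exact BentCumulantCS.dependsOn_lift_of_neg A.isCylinder _ hnegY
  have hXYD : DependsOn (fun U => X (torusConfigShift w U) * Y (torusConfigShift w U))
      {e : Edge 4 (2 * S + 1) | WilsonRP.edgeReflect e ∈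
        {e : Edge 4 (2 * S + 1) | WilsonOddRP.IsOPosEdge e ∨ WilsonOddRP.IsOSharedEdge e}} :=
    fun U V hUV => congrArg₂ (· * ·) (hXD hUV) (hYD hUV)
  have hZD : DependsOn (fun U => Z (torusConfigShift w U))
      {e : Edge 4 (2 * S + 1) | WilsonOddRP.IsOPosEdge e ∨ WilsonOddRP.IsOSharedEdge e} := by
    rw [hZw]
    exact BentCumulantCS.dependsOn_lift_of_pos r.curvature.isCylinder _ hposZ
  -- measurability / bounds after the translation
  have hXwm : Measurable fun U => X (torusConfigShift w U) :=
    hXm.comp (torusConfigShift w).measurable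
  have hYwm : Measurable fun U => Y (torusConfigShift w U) :=
    hYm.comp (torusConfigShift w).measurable
  have hZwm : Measurable fun U => Z (torusConfigShift w U) :=
    hZm.comp (torusConfigShift w).measurable
  have hXYwm : Measurable fun U => X (torusConfigShift w U) * Y (torusConfigShift w U) :=
    hXwm.mul hYwm
  have hbXY : ∀ U, |X (torusConfigShift w U) * Y (torusConfigShift w U)| ≤ B * B := fun U =>
    (abs_mul _ _).trans_le (mul_le_mul (hbX _) (hbY _) (abs_nonneg _) hB0)
  -- Step 3: the three Cauchy–Schwarz bounds
  obtain ⟨-, h1⟩ := BentCumulantCS.abs_cov_le_of_neg_pos r.ρ r.continuous hβ hS1 hXYwm hZwm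
    hbXY ⟨BP, fun U => hbZ _⟩ hXYD hZD
  obtain ⟨-, h2⟩ := BentCumulantCS.abs_cov_le_of_neg_pos r.ρ r.continuous hβ hS1 hYwm hZwm
    (fun U => hbY _) ⟨BP, fun U => hbZ _⟩ hYD hZD
  obtain ⟨-, h3⟩ := BentCumulantCS.abs_cov_le_of_neg_pos r.ρ r.continuous hβ hS1 hXwm hZwm
    (fun U => hbX _) ⟨BP, fun U => hbZ _⟩ hXD hZD
  rw [BentCumulantCS.cov_comp_torusConfigShift r.ρ β w (fun U => X U * Y U) Z] at h1
  rw [BentCumulantCS.cov_comp_torusConfigShift r.ρ β w Y Z] at h2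
  rw [BentCumulantCS.cov_comp_torusConfigShift r.ρ β w X Z] at h3
  -- Step 4: the bridge to `a_S(2s)`
  have hbridge : latticeConnectedCorr r.ρ β (2 * S + 1) (r.curvature.F ∘ gaugeTimeReflect)
      r.curvature.F (2 * s) =
      cov[fun U => Z (torusConfigShift w (GaugeConfig.timeReflect U)),
        fun U => Z (torusConfigShift w U); wilsonMeasure (d := 4) (L := 2 * S + 1) r.ρ β] := by
    rw [hZdef]
    exact BentCumulantCS.corr_theta_two_mul r.ρ r.continuous β S s r.curvature.measurable
      r.curvature.bounded
  -- Step 5: assembly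
  rw [hbridge]
  have hEX : |∫ U, X U ∂(wilsonMeasure (d := 4) (L := 2 * S + 1) r.ρ β)| ≤ B :=
    Literature.Probability.Moments.abs_integral_le_of_forall_abs_le hbX
  have hEY : |∫ U, Y U ∂(wilsonMeasure (d := 4) (L := 2 * S + 1) r.ρ β)| ≤ B :=
    Literature.Probability.Moments.abs_integral_le_of_forall_abs_le hbY
  exact BentCumulantCS.abs_cumulant_le hB0 hEX hEY h1 h2 h3

end Summit.QuantumFields.YangMills.Theorems.CriticalContinuumLimit

end
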